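import Summits.CriticalPhenomena.CardyFormulaZ2.Theorems.CardyBoundaryCoulombGasStripClusterRatesConfinedGlueTransfer
import Summits.CriticalPhenomena.CardyFormulaZ2.Theorems.CardyBoundaryCoulombGasStripClusterRatesConfinedUpperOfKacTwo
import HarnessLib

/-!
# A uniform exponential bound at the rate plus the Kac limit give the PLAIN Cardy-order upper bound

Support file for line `two-cluster-rate-is-stationary-gap` (crux `StripClusterRates`,
stmt-CriticalPhenomena-13878), lead c8, stub `c8_plainUpper_of_uniform_kacTwo` (T6f, "uniform exponential
bound + K₂ ⇒ plain Cardy-order upper bound along ALL widths").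

Let `p₂(m,n)` be the two-cluster long-crossing probability of `[0,m]×[0,n]` (bond percolation on `ℤ²` at
`p = 1/2`) and `γ₂ : ℕ → ℝ` a family of two-cluster rates in transfer-matrix order
(`−log p₂(m,n)/m → γ₂(n)` for every width `n ≥ 1`) with the Kac limit `n·γ₂(n) → 2π`. Assume the UNIFORM
exponential bound at the rate along the widths `3b+2`, `b ≥ b₀`:
`p₂(M, 3b+2) ≤ C·exp(−γ₂(3b+2)·M)` for all `M`. Then the plain Cardy-order upper bound holds along ALL
widths: there is `g : ℕ → ℝ` with `g(A)/A → 2π` and, for every integer aspect ratio `A ≥ 1`,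
`p₂(A·n, n) ≤ exp(−g(A))` eventually in `n`.

Proof. `p₂(m,·)` is monotone in the width (`pTwo_mono_right`), so with `b := n/3 + 1` and
`n' := 3b+2 ∈ [n+3, n+5]` one has `p₂(An, n) ≤ p₂(An, n') ≤ C·exp(−γ₂(n')·A·n)`. Since `γ₂ ≥ 0`
(`co2l_rateTwo_nonneg`) and `n ≥ n' − 5`, `n·γ₂(n') ≥ (n' − 5)·γ₂(n') → 2π` (Kac limit along `n' → ∞`,
and `γ₂(n') = (n'γ₂(n'))/n' → 0`), so eventually `A·n·γ₂(n') ≥ A(2π − 1/A) = 2πA − 1` and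
`p₂(An, n) ≤ C·exp(1 − 2πA) = exp(−g(A))` with `g(A) := 2πA − 1 − log C`, `g(A)/A → 2π`
(`cuk_tendsto_g_div`).

No definitions; `pTwo`, `rateSeqTwo` are the abbreviations of `Negative.KacFromAboveFalse`.

References: [Cardy1998] eq. (bb) (the exponent `2π = π·h_{1,5}`); elementary bookkeeping [folklore].
-/

noncomputable section

open MeasureTheory Filter Topology Set
open Literature.Probability.LatticeModels Literature.Probability.Percolation
open Summit.CriticalPhenomena.CardyFormulaZ2.Theorems.StripClusterRates.Negative (pOne pTwo rateSeqTwo rateSeqOne)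

namespace Summit.CriticalPhenomena.CardyFormulaZ2.Cruxes.StripClusterRates.TwoClusterRateIsStationaryGap

/-! ## §1 The comparison width `n' = 3(n/3+1)+2` -/

/-- The comparison width `n' = 3(n/3+1)+2 ∈ [n+3, n+5]` tends to infinity with `n`. [folklore] -/
theorem puk_tendsto_width : Tendsto (fun n : ℕ ↦ 3 * (n / 3 + 1) + 2) atTop atTop :=
  tendsto_atTop_mono (fun n : ℕ ↦ (by omega : n ≤ 3 * (n / 3 + 1) + 2)) tendsto_id

/-- Along the comparison widths `n' = 3(n/3+1)+2` the Kac limit gives `(n' − 5)·γ₂(n') → 2π`. [folklore] -/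
theorem puk_tendsto_shifted {γ₂ : ℕ → ℝ}
    (hK : Tendsto (fun n : ℕ ↦ (n : ℝ) * γ₂ n) atTop (𝓝 (2 * Real.pi))) :
    Tendsto (fun n : ℕ ↦ ((((3 * (n / 3 + 1) + 2 : ℕ) : ℝ)) - 5) * γ₂ (3 * (n / 3 + 1) + 2)) atTop
      (𝓝 (2 * Real.pi)) := by
  have h1 : Tendsto (fun n : ℕ ↦ (((3 * (n / 3 + 1) + 2 : ℕ) : ℝ)) * γ₂ (3 * (n / 3 + 1) + 2)) atTop
      (𝓝 (2 * Real.pi)) := hK.comp puk_tendsto_width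
  have h2 : Tendsto (fun n : ℕ ↦ (((3 * (n / 3 + 1) + 2 : ℕ) : ℝ))) atTop atTop :=
    tendsto_natCast_atTop_atTop.comp puk_tendsto_width
  have h3 : Tendsto (fun n : ℕ ↦ γ₂ (3 * (n / 3 + 1) + 2)) atTop (𝓝 0) := by
    refine (h1.div_atTop h2).congr' (Eventually.of_forall fun n ↦ ?_)
    have h0 : (((3 * (n / 3 + 1) + 2 : ℕ) : ℝ)) ≠ 0 := by positivity
    field_simp
  have h4 := h1.sub (h3.const_mul 5)
  rw [mul_zero, sub_zero] at h4
  refine h4.congr' (Eventually.of_forall fun n ↦ ?_)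
  ring

/-! ## §2 The plain Cardy-order upper bound with `g(A) = 2πA − 1 − log C` -/

/-- **Uniform exponential bound + Kac limit ⇒ plain Cardy-order upper bound.** If `−log p₂(m,n)/m → γ₂(n)`
for every width `n ≥ 1`, `n·γ₂(n) → 2π`, and `p₂(M, 3b+2) ≤ C·exp(−γ₂(3b+2)·M)` for all `M` and all
`b ≥ b₀`, then with `g(A) := 2πA + (−1 − log C)` one has `g(A)/A → 2π` and, for every `A ≥ 1`,
`p₂(A·n, n) ≤ exp(−g(A))` eventually in `n`. [cite: Cardy1998, eq. (bb)] -/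
theorem puk_plainUpper {γ₂ : ℕ → ℝ} (h₂ : ∀ n : ℕ, 1 ≤ n → Tendsto (rateSeqTwo n) atTop (𝓝 (γ₂ n)))
    (hK : Tendsto (fun n : ℕ ↦ (n : ℝ) * γ₂ n) atTop (𝓝 (2 * Real.pi)))
    {C : ℝ} (hC : 0 < C) {b₀ : ℕ}
    (hU : ∀ b : ℕ, b₀ ≤ b → ∀ M : ℕ, pTwo M (3 * b + 2) ≤ C * Real.exp (-(γ₂ (3 * b + 2) * M))) :
    ∃ g : ℕ → ℝ, Tendsto (fun A : ℕ ↦ g A / A) atTop (𝓝 (2 * Real.pi)) ∧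
      ∀ A : ℕ, 1 ≤ A → ∀ᶠ n : ℕ in atTop, pTwo (A * n) n ≤ Real.exp (-g A) := by
  refine ⟨fun A ↦ 2 * Real.pi * A + (-1 - Real.log C), cuk_tendsto_g_div _, fun A hA ↦ ?_⟩
  have hA' : (0 : ℝ) < A := by exact_mod_cast hA
  have hlt : 2 * Real.pi - 1 / (A : ℝ) < 2 * Real.pi := by
    have : (0 : ℝ) < 1 / (A : ℝ) := by positivity
    linarith
  filter_upwards [(puk_tendsto_shifted hK).eventually_const_le hlt, eventually_ge_atTop (3 * b₀)]
    with n hn hnb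
  set b : ℕ := n / 3 + 1 with hb
  have hb₀ : b₀ ≤ b := by omega
  have hnn' : n ≤ 3 * b + 2 := by omega
  have hn'n : 3 * b + 2 ≤ n + 5 := by omega
  have hn'1 : 1 ≤ 3 * b + 2 := by omega
  have hγ0 : 0 ≤ γ₂ (3 * b + 2) := co2l_rateTwo_nonneg hn'1 (h₂ _ hn'1)
  have hcast : (((3 * b + 2 : ℕ) : ℝ)) - 5 ≤ (n : ℝ) := by
    have : (((3 * b + 2 : ℕ) : ℝ)) ≤ (n : ℝ) + 5 := by exact_mod_cast hn'n
    linarith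
  have h1 : ((((3 * b + 2 : ℕ) : ℝ)) - 5) * γ₂ (3 * b + 2) ≤ (n : ℝ) * γ₂ (3 * b + 2) :=
    mul_le_mul_of_nonneg_right hcast hγ0
  have h2 : 2 * Real.pi - 1 / (A : ℝ) ≤ (n : ℝ) * γ₂ (3 * b + 2) := hn.trans h1
  have h3 : (A : ℝ) * (2 * Real.pi - 1 / (A : ℝ)) ≤ (A : ℝ) * ((n : ℝ) * γ₂ (3 * b + 2)) :=
    mul_le_mul_of_nonneg_left h2 hA'.le
  have h4 : (A : ℝ) * (2 * Real.pi - 1 / (A : ℝ)) = 2 * Real.pi * A - 1 := by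
    rw [mul_sub, mul_one_div_cancel hA'.ne']; ring
  have h5 : γ₂ (3 * b + 2) * ((A * n : ℕ) : ℝ) = (A : ℝ) * ((n : ℝ) * γ₂ (3 * b + 2)) := by
    push_cast; ring
  have h6 : -(γ₂ (3 * b + 2) * ((A * n : ℕ) : ℝ)) ≤ -(2 * Real.pi * A - 1) := by
    rw [h5]; linarith
  have h7 : Real.exp (-(2 * Real.pi * A + (-1 - Real.log C))) =
      C * Real.exp (-(2 * Real.pi * A - 1)) := by
    rw [← Real.exp_log hC, ← Real.exp_add, Real.log_exp]
    congr 1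
    ring
  show pTwo (A * n) n ≤ Real.exp (-(2 * Real.pi * A + (-1 - Real.log C)))
  calc pTwo (A * n) n ≤ pTwo (A * n) (3 * b + 2) := pTwo_mono_right _ hnn'
    _ ≤ C * Real.exp (-(γ₂ (3 * b + 2) * ((A * n : ℕ) : ℝ))) := hU b hb₀ (A * n)
    _ ≤ C * Real.exp (-(2 * Real.pi * A - 1)) := mul_le_mul_of_nonneg_left (Real.exp_le_exp.2 h6) hC.le
    _ = Real.exp (-(2 * Real.pi * A + (-1 - Real.log C))) := h7.symm

/-- **Registered form** (stub `c8_plainUpper_of_uniform_kacTwo` of stmt-CriticalPhenomena-13878, lead c8; T6f):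
for any family `γ₂` of two-cluster rates with the Kac limit `n·γ₂(n) → 2π`, a uniform exponential upper bound
`p₂(M, 3b+2) ≤ C·exp(−γ₂(3b+2)·M)` (`b ≥ b₀`, all `M`) implies the plain Cardy-order upper bound along all
widths: `∃ g, g(A)/A → 2π ∧ ∀ A ≥ 1, ∀ᶠ n, p₂(A·n, n) ≤ exp(−g(A))` (= `puk_plainUpper`, by monotonicity of
`p₂` in the width). [cite: Cardy1998, eq. (bb)] -/
theorem c8_plainUpper_of_uniform_kacTwo : ∀ γ₂ : ℕ → ℝ, (∀ n : ℕ, 1 ≤ n → Tendsto (rateSeqTwo n) atTop (𝓝 (γ₂ n))) → Tendsto (fun n : ℕ ↦ (n : ℝ) * γ₂ n) atTop (𝓝 (2 * Real.pi)) → (∃ C : ℝ, 0 < C ∧ ∃ b₀ : ℕ, ∀ b : ℕ, b₀ ≤ b → ∀ M : ℕ, pTwo M (3 * b + 2) ≤ C * Real.exp (-(γ₂ (3 * b + 2) * M))) → (∃ g : ℕ → ℝ, Tendsto (fun A : ℕ ↦ g A / A) atTop (𝓝 (2 * Real.pi)) ∧ ∀ A : ℕ, 1 ≤ A → ∀ᶠ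 n : ℕ in atTop, pTwo (A * n) n ≤ Real.exp (-g A)) :=
  fun _ h₂ hK ⟨_, hC, _, hU⟩ => puk_plainUpper h₂ hK hC hU

end Summit.CriticalPhenomena.CardyFormulaZ2.Cruxes.StripClusterRates.TwoClusterRateIsStationaryGap

end
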